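import Summits.ValiantsHypothesis.ValiantsHypothesis.Theorems.LacunarySymmetroidMatrixDescartesDoorA26WallBubblingDoublyConfluentLimit
import Summits.ValiantsHypothesis.ValiantsHypothesis.Theorems.LacunarySymmetroidMatrixDescartesDoorA26WallBubblingDoublyConfluentNondegWallC1
import Summits.ValiantsHypothesis.ValiantsHypothesis.Theorems.LacunarySymmetroidMatrixDescartesDoorA26WallBubblingDoublyConfluentNondegWallC2
import Summits.ValiantsHypothesis.ValiantsHypothesis.Theorems.LacunarySymmetroidMatrixDescartesDoorA26WallBubblingDoublyConfluentNondegWallC3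
import Summits.ValiantsHypothesis.ValiantsHypothesis.Theorems.LacunarySymmetroidMatrixDescartesDoorA26WallBubblingDoublyConfluentCount
import Summits.ValiantsHypothesis.ValiantsHypothesis.Theorems.LacunarySymmetroidMatrixDescartesDoorA26WallBubblingWeylGenericSingleCluster

/-!
# Wall bubbling for `DoorA26` — TWO WEYL PAIRS: THE SINGLE-CLUSTER BRANCH IS DOOR-FREE (value-generic stratum and the wall strata (c1)/(c2)/(c3))

HONEST FRAMING.  Obligation (W) `stub_weylFaces` of `Cruxes/DoorA26/Lines/wall_bubbling.lean` (crux `DoorA26`, stmt-ValiantsHypothesis-19979,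
`= PosRootLawAt 2 6 19`; OPEN, typed, never asserted); statement file `Cruxes/DoorA26/Lines/wall_bubbling_ConfluentDoor.lean` rev 4: the strata
with TWO Weyl pairs and four distinct values `e₀ = δ₀ = δ₅`, `e₁ = δ₁ = δ₄`, `e₂, e₃` — `Stmt.weylFaces_deepVal` (value-generic) and
`Stmt.weylFaces_wall` ((c1) `e₀ + e₁ = e₂ + e₃`, (c2) `e₀ + e₂ = e₁ + e₃`, (c3) `e₀ + e₃ = e₁ + e₂`; W1 #14 itemisation, (c2)/(c3) NAMED OPEN R2779).
W1 seat val-sym-door-p2 g13 (#28).  W2's single-cluster branch at a GENERIC face (`…WeylGenericSingleCluster`, door-p1 g14) needs the door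
`ConfluentDoor26` as a hypothesis; at TWO Weyl pairs NO DOOR IS NEEDED:

* `no_twenty_window_twoWeylPairs_of_nondeg` — MASTER: along ANY sequence of genuine real-exponent `(2,6)` pencils `t ↦ det Σ_l e^{δ^ν_l t}U^ν_l`
  (symmetric letters, not identically zero) whose exponents converge to `δ0` with `δ0 5 = δ0 0`, `δ0 4 = δ0 1`, twenty zeros in a FIXED window
  `[A,B]` are impossible PROVIDED every symmetric frame with a non-zero polar Gram entry has a non-identically-zero doubly-confluent determinant at
  `δ0` (the stratum's non-degeneracy).  Proof: `doublyConfluentLimit` (W1 #27) + multiplicity transfer (W2 `…ConfluentTower`) + the COUNT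
  `doublyConfluent_count_conclusion` (W1 #24: `≤ 19` with multiplicity for EVERY doubly-confluent determinant);
* **`no_twenty_window_twoWeylPairs`** (value-generic, W1 #26), **`…_wallC1`**, **`…_wallC2`**, **`…_wallC3`** (W1 #26d/#26b/#26c) — the four
  strata, UNCONDITIONALLY;
* `no_boundedRatio_twenties_twoWeylPairs_of_nondeg` and the four corollaries `no_boundedRatio_twenties_twoWeylPairs{,_wallC1,_wallC2,_wallC3}` —
  `x`-currency: near such a point there is no sequence of twenties (`det Σ_l x^{δ^ν_l}S^ν_l = 0` at `0 < x^ν_1 < ⋯ < x^ν_20`) with BOUNDED ROOT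
  RATIO `x^ν_20 ≤ R·x^ν_1`: twenties accumulating at a two-Weyl-pair point SPLIT.

WHAT THIS IS AND IS NOT.  It is the «one cluster» branch at every two-Weyl-pair stratum with four distinct values and no mixed relation, closed in
the kernel WITHOUT any door.  COVERAGE (crit-2 g4, 2026-08-28T23:16Z): among four distinct values two disjoint-type relations cannot coexist (they
would force two values equal), so «value-generic ∨ (c1) ∨ (c2) ∨ (c3)» IS every two-pair point WITHOUT a mixed (midpoint) relation `2e_a = e_b + e_c`;
two-pair points WITH a midpoint relation (alone or together with a disjoint one) are NOT covered here — they are (M)'s (`Stmt.stub_mixedWalls` carries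
no Weyl hypothesis; bookkeeping `weylFaces_deep_of_split`), and their Gram has further special classes (the realisable MIXED pattern among them).  Accumulations whose log-roots SPLIT into ≥ 2 clusters («broken chains») are the shared (W-split) middle (W2 g15's
tight-chain theorem; at two pairs the class `e₀ + e₁` has three slots in every cluster).  Positions are fixed (`0,5` / `1,4` / `2,3`); other
positions by relabelling the letters.  Registers unchanged; (W), `ConfluentDoor26`, `DoorA26`, `MatrixDescartes` (stmt-ValiantsHypothesis-18050)
OPEN; nothing on VP ≠ VNP.  No new definitions.  `--supports stmt-ValiantsHypothesis-19979 --as helper`.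

[this work] the assembly; [folklore] logarithmic coordinates.
-/

-- `Summit.ValiantsHypothesis.ValiantsHypothesis.…` repeats a component by the D-0017 layout
-- (single-conjunct summit), which the `dupNamespace` linter flags; the name is mandated.
set_option linter.dupNamespace false

namespace Summit.ValiantsHypothesis.ValiantsHypothesis.Theorems.LacunarySymmetroidMatrixDescartes.WallBubbling

open Finset Filter Topology
open Bubbling (polar doublyConfluent_count_conclusion)
open scoped BigOperators

/-! ## 1. The master window lemma: positions `0,5` and `1,4`, non-degeneracy as the stratum input -/

/-- **NO TWENTY IN A WINDOW AT A TWO-WEYL-PAIR POINT, GIVEN THE STRATUM'S NON-DEGENERACY — NO DOOR.** [this work] -/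
theorem no_twenty_window_twoWeylPairs_of_nondeg
    (δs : ℕ → Fin 6 → ℝ) (δ0 : Fin 6 → ℝ) (hδ : ∀ l, Tendsto (fun ν => δs ν l) atTop (𝓝 (δ0 l)))
    (h50 : δ0 5 = δ0 0) (h41 : δ0 4 = δ0 1)
    (hnd : ∀ W : Fin 6 → Matrix (Fin 2) (Fin 2) ℝ, (∀ l, (W l).IsSymm) → (∃ p q, polar (W p) (W q) ≠ 0) →
      ∃ t, ((Real.exp (δ0 0 * t)) • (W 0 + t • W 5) + (Real.exp (δ0 1 * t)) • (W 1 + t • W 4)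
        + ∑ k : Fin 2, (Real.exp (δ0 k.succ.succ.castSucc.castSucc * t)) • W k.succ.succ.castSucc.castSucc).det ≠ 0)
    (U : ℕ → Fin 6 → Matrix (Fin 2) (Fin 2) ℝ) (hU : ∀ ν l, (U ν l).IsSymm)
    (hne : ∀ ν, ∃ t, (∑ l, Real.exp (δs ν l * t) • U ν l).det ≠ 0)
    (A B : ℝ) (hz : ∀ ν, ∃ z : Fin 20 → ℝ, StrictMono z ∧ ∀ i, z i ∈ Set.Icc A B ∧ (∑ l, Real.exp (δs ν l * z i) • U ν l).det = 0) :
    False := by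
  obtain ⟨φ, hφ, a, W, hWs, hWne, hconv⟩ := doublyConfluentLimit δs δ0 hδ h50 h41 U hU hne
  have hne' := hnd W hWs hWne
  obtain ⟨E, hE⟩ : ∃ E : Fin 4 → ℝ, ∀ m, E m = δ0 m.castSucc.castSucc := ⟨fun m => δ0 m.castSucc.castSucc, fun m => rfl⟩
  have hE0 : E 0 = δ0 0 := by rw [hE]; rfl
  have hE1 : E 1 = δ0 1 := by rw [hE]; rfl
  have hEs : ∀ k : Fin 2, E k.succ.succ = δ0 k.succ.succ.castSucc.castSucc := fun k => hE _
  have hfun : (fun t : ℝ => ((Real.exp (E 0 * t)) • (W 0 + t • W 5) + (Real.exp (E 1 * t)) • (W 1 + t • W 4)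
        + ∑ k : Fin 2, (Real.exp (E k.succ.succ * t)) • W k.succ.succ.castSucc.castSucc).det)
      = (fun t => ((Real.exp (δ0 0 * t)) • (W 0 + t • W 5) + (Real.exp (δ0 1 * t)) • (W 1 + t • W 4)
        + ∑ k : Fin 2, (Real.exp (δ0 k.succ.succ.castSucc.castSucc * t)) • W k.succ.succ.castSucc.castSucc).det) := by
    simp only [hE0, hE1, hEs]
  obtain ⟨Z, m, hZ, h20⟩ := multiplicity_transfer_iteratedDeriv A B
    (fun k t => a k * (∑ l, Real.exp (δs (φ k) l * t) • U (φ k) l).det)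
    (fun t => ((Real.exp (δ0 0 * t)) • (W 0 + t • W 5) + (Real.exp (δ0 1 * t)) • (W 1 + t • W 4)
        + ∑ k : Fin 2, (Real.exp (δ0 k.succ.succ.castSucc.castSucc * t)) • W k.succ.succ.castSucc.castSucc).det)
    (fun k n => contDiff_const.mul (contDiff_pencilDet _ _ n))
    (fun j _ ψ hψ t t₀ _ ht => hconv j ψ hψ t t₀ ht)
    (fun k => by
      obtain ⟨z, hz1, hz2⟩ := hz (φ k)
      exact ⟨z, hz1, fun i => ⟨(hz2 i).1, by rw [(hz2 i).2, mul_zero]⟩⟩)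
  have h19 := doublyConfluent_count_conclusion E (W 0) (W 5) (W 1) (W 4) (fun k => W k.succ.succ.castSucc.castSucc)
    (by simp only [hE0, hE1, hEs]; exact hne') Z m (fun z hz' j hj => by rw [hfun]; exact (hZ z hz').2 j hj)
  omega

/-! ## 2. The four strata, unconditionally -/

/-- **NO TWENTY IN A WINDOW AT A VALUE-GENERIC TWO-WEYL-PAIR POINT — NO DOOR.**  Pair A at `0,5`, pair B at `1,4`; the four values
`δ0 0, δ0 1, δ0 2, δ0 3` value-generic (`hvg`). [this work] -/
theorem no_twenty_window_twoWeylPairs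
    (δs : ℕ → Fin 6 → ℝ) (δ0 : Fin 6 → ℝ) (hδ : ∀ l, Tendsto (fun ν => δs ν l) atTop (𝓝 (δ0 l)))
    (h50 : δ0 5 = δ0 0) (h41 : δ0 4 = δ0 1)
    (hvg : ∀ a b c d : Fin 4, δ0 a.castSucc.castSucc + δ0 b.castSucc.castSucc = δ0 c.castSucc.castSucc + δ0 d.castSucc.castSucc →
      (a = c ∧ b = d) ∨ (a = d ∧ b = c))
    (U : ℕ → Fin 6 → Matrix (Fin 2) (Fin 2) ℝ) (hU : ∀ ν l, (U ν l).IsSymm)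
    (hne : ∀ ν, ∃ t, (∑ l, Real.exp (δs ν l * t) • U ν l).det ≠ 0)
    (A B : ℝ) (hz : ∀ ν, ∃ z : Fin 20 → ℝ, StrictMono z ∧ ∀ i, z i ∈ Set.Icc A B ∧ (∑ l, Real.exp (δs ν l * z i) • U ν l).det = 0) :
    False :=
  no_twenty_window_twoWeylPairs_of_nondeg δs δ0 hδ h50 h41
    (fun W hWs hWne => doublyConfluentDet_ne_zero_of_polar_ne_zero δ0 h50 h41 hvg W hWs hWne) U hU hne A B hz

/-- **NO TWENTY IN A WINDOW AT A TWO-WEYL-PAIR POINT ON THE WALL (c1) `δ₀ + δ₁ = δ₂ + δ₃` — NO DOOR.** [this work] -/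
theorem no_twenty_window_twoWeylPairs_wallC1
    (δs : ℕ → Fin 6 → ℝ) (δ0 : Fin 6 → ℝ) (hδ : ∀ l, Tendsto (fun ν => δs ν l) atTop (𝓝 (δ0 l)))
    (h50 : δ0 5 = δ0 0) (h41 : δ0 4 = δ0 1) (hrel : δ0 0 + δ0 1 = δ0 2 + δ0 3)
    (hgen : ∀ a b c e : Fin 4, δ0 a.castSucc.castSucc + δ0 b.castSucc.castSucc = δ0 c.castSucc.castSucc + δ0 e.castSucc.castSucc →
      (a = c ∧ b = e) ∨ (a = e ∧ b = c) ∨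
        (((a = 0 ∧ b = 1) ∨ (a = 1 ∧ b = 0)) ∧ ((c = 2 ∧ e = 3) ∨ (c = 3 ∧ e = 2))) ∨
        (((a = 2 ∧ b = 3) ∨ (a = 3 ∧ b = 2)) ∧ ((c = 0 ∧ e = 1) ∨ (c = 1 ∧ e = 0))))
    (U : ℕ → Fin 6 → Matrix (Fin 2) (Fin 2) ℝ) (hU : ∀ ν l, (U ν l).IsSymm)
    (hne : ∀ ν, ∃ t, (∑ l, Real.exp (δs ν l * t) • U ν l).det ≠ 0)
    (A B : ℝ) (hz : ∀ ν, ∃ z : Fin 20 → ℝ, StrictMono z ∧ ∀ i, z i ∈ Set.Icc A B ∧ (∑ l, Real.exp (δs ν l * z i) • U ν l).det = 0) :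
    False :=
  no_twenty_window_twoWeylPairs_of_nondeg δs δ0 hδ h50 h41
    (fun W hWs hWne => doublyConfluentDet_ne_zero_of_polar_ne_zero_wallC1 δ0 h50 h41 hrel hgen W hWs hWne) U hU hne A B hz

/-- **NO TWENTY IN A WINDOW AT A TWO-WEYL-PAIR POINT ON THE WALL (c2) `δ₀ + δ₂ = δ₁ + δ₃` — NO DOOR.** [this work] -/
theorem no_twenty_window_twoWeylPairs_wallC2
    (δs : ℕ → Fin 6 → ℝ) (δ0 : Fin 6 → ℝ) (hδ : ∀ l, Tendsto (fun ν => δs ν l) atTop (𝓝 (δ0 l)))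
    (h50 : δ0 5 = δ0 0) (h41 : δ0 4 = δ0 1) (hrel : δ0 0 + δ0 2 = δ0 1 + δ0 3)
    (hgen : ∀ a b c e : Fin 4, δ0 a.castSucc.castSucc + δ0 b.castSucc.castSucc = δ0 c.castSucc.castSucc + δ0 e.castSucc.castSucc →
      (a = c ∧ b = e) ∨ (a = e ∧ b = c) ∨
        (((a = 0 ∧ b = 2) ∨ (a = 2 ∧ b = 0)) ∧ ((c = 1 ∧ e = 3) ∨ (c = 3 ∧ e = 1))) ∨
        (((a = 1 ∧ b = 3) ∨ (a = 3 ∧ b = 1)) ∧ ((c = 0 ∧ e = 2) ∨ (c = 2 ∧ e = 0))))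
    (U : ℕ → Fin 6 → Matrix (Fin 2) (Fin 2) ℝ) (hU : ∀ ν l, (U ν l).IsSymm)
    (hne : ∀ ν, ∃ t, (∑ l, Real.exp (δs ν l * t) • U ν l).det ≠ 0)
    (A B : ℝ) (hz : ∀ ν, ∃ z : Fin 20 → ℝ, StrictMono z ∧ ∀ i, z i ∈ Set.Icc A B ∧ (∑ l, Real.exp (δs ν l * z i) • U ν l).det = 0) :
    False :=
  no_twenty_window_twoWeylPairs_of_nondeg δs δ0 hδ h50 h41
    (fun W hWs hWne => doublyConfluentDet_ne_zero_of_polar_ne_zero_wallC2 δ0 h50 h41 hrel hgen W hWs hWne) U hU hne A B hz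

/-- **NO TWENTY IN A WINDOW AT A TWO-WEYL-PAIR POINT ON THE WALL (c3) `δ₀ + δ₃ = δ₁ + δ₂` — NO DOOR.** [this work] -/
theorem no_twenty_window_twoWeylPairs_wallC3
    (δs : ℕ → Fin 6 → ℝ) (δ0 : Fin 6 → ℝ) (hδ : ∀ l, Tendsto (fun ν => δs ν l) atTop (𝓝 (δ0 l)))
    (h50 : δ0 5 = δ0 0) (h41 : δ0 4 = δ0 1) (hrel : δ0 0 + δ0 3 = δ0 1 + δ0 2)
    (hgen : ∀ a b c e : Fin 4, δ0 a.castSucc.castSucc + δ0 b.castSucc.castSucc = δ0 c.castSucc.castSucc + δ0 e.castSucc.castSucc →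
      (a = c ∧ b = e) ∨ (a = e ∧ b = c) ∨
        (((a = 0 ∧ b = 3) ∨ (a = 3 ∧ b = 0)) ∧ ((c = 1 ∧ e = 2) ∨ (c = 2 ∧ e = 1))) ∨
        (((a = 1 ∧ b = 2) ∨ (a = 2 ∧ b = 1)) ∧ ((c = 0 ∧ e = 3) ∨ (c = 3 ∧ e = 0))))
    (U : ℕ → Fin 6 → Matrix (Fin 2) (Fin 2) ℝ) (hU : ∀ ν l, (U ν l).IsSymm)
    (hne : ∀ ν, ∃ t, (∑ l, Real.exp (δs ν l * t) • U ν l).det ≠ 0)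
    (A B : ℝ) (hz : ∀ ν, ∃ z : Fin 20 → ℝ, StrictMono z ∧ ∀ i, z i ∈ Set.Icc A B ∧ (∑ l, Real.exp (δs ν l * z i) • U ν l).det = 0) :
    False :=
  no_twenty_window_twoWeylPairs_of_nondeg δs δ0 hδ h50 h41
    (fun W hWs hWne => doublyConfluentDet_ne_zero_of_polar_ne_zero_wallC3 δ0 h50 h41 hrel hgen W hWs hWne) U hU hne A B hz

/-! ## 3. The `x`-currency statements: no bounded-ratio twenties near a two-Weyl-pair point -/

/-- **NO BOUNDED-RATIO TWENTIES NEAR A TWO-WEYL-PAIR POINT, GIVEN THE STRATUM'S NON-DEGENERACY — NO DOOR.**  If `δ^ν → δ0` with `δ0 5 = δ0 0`,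
`δ0 4 = δ0 1`, there is no sequence of symmetric letters `S^ν` and positive roots `x^ν_1 < ⋯ < x^ν_20` of `det Σ_l x^{δ^ν_l} S^ν_l` (determinant
not identically zero on `(0,∞)`) with `x^ν_20 ≤ R·x^ν_1` for a fixed `R`.  The split branch is NOT covered (module docstring). [this work] -/
theorem no_boundedRatio_twenties_twoWeylPairs_of_nondeg
    (δ0 : Fin 6 → ℝ) (h50 : δ0 5 = δ0 0) (h41 : δ0 4 = δ0 1)
    (hnd : ∀ W : Fin 6 → Matrix (Fin 2) (Fin 2) ℝ, (∀ l, (W l).IsSymm) → (∃ p q, polar (W p) (W q) ≠ 0) →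
      ∃ t, ((Real.exp (δ0 0 * t)) • (W 0 + t • W 5) + (Real.exp (δ0 1 * t)) • (W 1 + t • W 4)
        + ∑ k : Fin 2, (Real.exp (δ0 k.succ.succ.castSucc.castSucc * t)) • W k.succ.succ.castSucc.castSucc).det ≠ 0)
    (δs : ℕ → Fin 6 → ℝ) (hδ : ∀ l, Tendsto (fun ν => δs ν l) atTop (𝓝 (δ0 l)))
    (S : ℕ → Fin 6 → Matrix (Fin 2) (Fin 2) ℝ) (hS : ∀ ν l, (S ν l).IsSymm)
    (hne : ∀ ν, ∃ y : ℝ, 0 < y ∧ (∑ l, (y ^ (δs ν l)) • S ν l).det ≠ 0)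
    (R : ℝ) (x : ℕ → Fin 20 → ℝ) (hx : ∀ ν, StrictMono (x ν)) (hxpos : ∀ ν k, 0 < x ν k)
    (hxR : ∀ ν k, x ν k ≤ R * x ν 0) (hroot : ∀ ν k, (∑ l, (x ν k ^ (δs ν l)) • S ν l).det = 0) : False := by
  have hR : 0 < R := by
    have h1 := hxR 0 0
    have h2 := hxpos 0 0
    nlinarith
  -- recentred letters and logarithmic roots
  refine no_twenty_window_twoWeylPairs_of_nondeg δs δ0 hδ h50 h41 hnd
    (fun ν l => (x ν 0 ^ (δs ν l)) • S ν l) (fun ν l => (hS ν l).smul _) ?_ 0 (Real.log R) ?_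
  · intro ν
    obtain ⟨y, hy, hdet⟩ := hne ν
    refine ⟨Real.log y - Real.log (x ν 0), ?_⟩
    rw [← pencil_log_recenter (δs ν) (S ν) (hxpos ν 0) hy]
    exact hdet
  · intro ν
    refine ⟨fun k => Real.log (x ν k) - Real.log (x ν 0), fun k k' hkk' => ?_, fun k => ⟨⟨?_, ?_⟩, ?_⟩⟩
    · exact sub_lt_sub_right (Real.log_lt_log (hxpos ν k) (hx ν hkk')) _
    · exact sub_nonneg.mpr (Real.log_le_log (hxpos ν 0) ((hx ν).monotone (Fin.zero_le k)))
    · rw [sub_le_iff_le_add, ← Real.log_mul hR.ne' (hxpos ν 0).ne']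
      exact Real.log_le_log (hxpos ν k) (hxR ν k)
    · rw [← pencil_log_recenter (δs ν) (S ν) (hxpos ν 0) (hxpos ν k)]
      exact hroot ν k

/-- **NO BOUNDED-RATIO TWENTIES NEAR A VALUE-GENERIC TWO-WEYL-PAIR POINT — NO DOOR.** [this work] -/
theorem no_boundedRatio_twenties_twoWeylPairs
    (δ0 : Fin 6 → ℝ) (h50 : δ0 5 = δ0 0) (h41 : δ0 4 = δ0 1)
    (hvg : ∀ a b c d : Fin 4, δ0 a.castSucc.castSucc + δ0 b.castSucc.castSucc = δ0 c.castSucc.castSucc + δ0 d.castSucc.castSucc →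
      (a = c ∧ b = d) ∨ (a = d ∧ b = c))
    (δs : ℕ → Fin 6 → ℝ) (hδ : ∀ l, Tendsto (fun ν => δs ν l) atTop (𝓝 (δ0 l)))
    (S : ℕ → Fin 6 → Matrix (Fin 2) (Fin 2) ℝ) (hS : ∀ ν l, (S ν l).IsSymm)
    (hne : ∀ ν, ∃ y : ℝ, 0 < y ∧ (∑ l, (y ^ (δs ν l)) • S ν l).det ≠ 0)
    (R : ℝ) (x : ℕ → Fin 20 → ℝ) (hx : ∀ ν, StrictMono (x ν)) (hxpos : ∀ ν k, 0 < x ν k)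
    (hxR : ∀ ν k, x ν k ≤ R * x ν 0) (hroot : ∀ ν k, (∑ l, (x ν k ^ (δs ν l)) • S ν l).det = 0) : False :=
  no_boundedRatio_twenties_twoWeylPairs_of_nondeg δ0 h50 h41
    (fun W hWs hWne => doublyConfluentDet_ne_zero_of_polar_ne_zero δ0 h50 h41 hvg W hWs hWne) δs hδ S hS hne R x hx hxpos hxR hroot

/-- **NO BOUNDED-RATIO TWENTIES NEAR A TWO-WEYL-PAIR POINT ON THE WALL (c1) — NO DOOR.** [this work] -/
theorem no_boundedRatio_twenties_twoWeylPairs_wallC1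
    (δ0 : Fin 6 → ℝ) (h50 : δ0 5 = δ0 0) (h41 : δ0 4 = δ0 1) (hrel : δ0 0 + δ0 1 = δ0 2 + δ0 3)
    (hgen : ∀ a b c e : Fin 4, δ0 a.castSucc.castSucc + δ0 b.castSucc.castSucc = δ0 c.castSucc.castSucc + δ0 e.castSucc.castSucc →
      (a = c ∧ b = e) ∨ (a = e ∧ b = c) ∨
        (((a = 0 ∧ b = 1) ∨ (a = 1 ∧ b = 0)) ∧ ((c = 2 ∧ e = 3) ∨ (c = 3 ∧ e = 2))) ∨
        (((a = 2 ∧ b = 3) ∨ (a = 3 ∧ b = 2)) ∧ ((c = 0 ∧ e = 1) ∨ (c = 1 ∧ e = 0))))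
    (δs : ℕ → Fin 6 → ℝ) (hδ : ∀ l, Tendsto (fun ν => δs ν l) atTop (𝓝 (δ0 l)))
    (S : ℕ → Fin 6 → Matrix (Fin 2) (Fin 2) ℝ) (hS : ∀ ν l, (S ν l).IsSymm)
    (hne : ∀ ν, ∃ y : ℝ, 0 < y ∧ (∑ l, (y ^ (δs ν l)) • S ν l).det ≠ 0)
    (R : ℝ) (x : ℕ → Fin 20 → ℝ) (hx : ∀ ν, StrictMono (x ν)) (hxpos : ∀ ν k, 0 < x ν k)
    (hxR : ∀ ν k, x ν k ≤ R * x ν 0) (hroot : ∀ ν k, (∑ l, (x ν k ^ (δs ν l)) • S ν l).det = 0) : False :=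
  no_boundedRatio_twenties_twoWeylPairs_of_nondeg δ0 h50 h41
    (fun W hWs hWne => doublyConfluentDet_ne_zero_of_polar_ne_zero_wallC1 δ0 h50 h41 hrel hgen W hWs hWne)
    δs hδ S hS hne R x hx hxpos hxR hroot

/-- **NO BOUNDED-RATIO TWENTIES NEAR A TWO-WEYL-PAIR POINT ON THE WALL (c2) — NO DOOR.** [this work] -/
theorem no_boundedRatio_twenties_twoWeylPairs_wallC2
    (δ0 : Fin 6 → ℝ) (h50 : δ0 5 = δ0 0) (h41 : δ0 4 = δ0 1) (hrel : δ0 0 + δ0 2 = δ0 1 + δ0 3)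
    (hgen : ∀ a b c e : Fin 4, δ0 a.castSucc.castSucc + δ0 b.castSucc.castSucc = δ0 c.castSucc.castSucc + δ0 e.castSucc.castSucc →
      (a = c ∧ b = e) ∨ (a = e ∧ b = c) ∨
        (((a = 0 ∧ b = 2) ∨ (a = 2 ∧ b = 0)) ∧ ((c = 1 ∧ e = 3) ∨ (c = 3 ∧ e = 1))) ∨
        (((a = 1 ∧ b = 3) ∨ (a = 3 ∧ b = 1)) ∧ ((c = 0 ∧ e = 2) ∨ (c = 2 ∧ e = 0))))
    (δs : ℕ → Fin 6 → ℝ) (hδ : ∀ l, Tendsto (fun ν => δs ν l) atTop (𝓝 (δ0 l)))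
    (S : ℕ → Fin 6 → Matrix (Fin 2) (Fin 2) ℝ) (hS : ∀ ν l, (S ν l).IsSymm)
    (hne : ∀ ν, ∃ y : ℝ, 0 < y ∧ (∑ l, (y ^ (δs ν l)) • S ν l).det ≠ 0)
    (R : ℝ) (x : ℕ → Fin 20 → ℝ) (hx : ∀ ν, StrictMono (x ν)) (hxpos : ∀ ν k, 0 < x ν k)
    (hxR : ∀ ν k, x ν k ≤ R * x ν 0) (hroot : ∀ ν k, (∑ l, (x ν k ^ (δs ν l)) • S ν l).det = 0) : False :=
  no_boundedRatio_twenties_twoWeylPairs_of_nondeg δ0 h50 h41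
    (fun W hWs hWne => doublyConfluentDet_ne_zero_of_polar_ne_zero_wallC2 δ0 h50 h41 hrel hgen W hWs hWne)
    δs hδ S hS hne R x hx hxpos hxR hroot

/-- **NO BOUNDED-RATIO TWENTIES NEAR A TWO-WEYL-PAIR POINT ON THE WALL (c3) — NO DOOR.** [this work] -/
theorem no_boundedRatio_twenties_twoWeylPairs_wallC3
    (δ0 : Fin 6 → ℝ) (h50 : δ0 5 = δ0 0) (h41 : δ0 4 = δ0 1) (hrel : δ0 0 + δ0 3 = δ0 1 + δ0 2)
    (hgen : ∀ a b c e : Fin 4, δ0 a.castSucc.castSucc + δ0 b.castSucc.castSucc = δ0 c.castSucc.castSucc + δ0 e.castSucc.castSucc →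
      (a = c ∧ b = e) ∨ (a = e ∧ b = c) ∨
        (((a = 0 ∧ b = 3) ∨ (a = 3 ∧ b = 0)) ∧ ((c = 1 ∧ e = 2) ∨ (c = 2 ∧ e = 1))) ∨
        (((a = 1 ∧ b = 2) ∨ (a = 2 ∧ b = 1)) ∧ ((c = 0 ∧ e = 3) ∨ (c = 3 ∧ e = 0))))
    (δs : ℕ → Fin 6 → ℝ) (hδ : ∀ l, Tendsto (fun ν => δs ν l) atTop (𝓝 (δ0 l)))
    (S : ℕ → Fin 6 → Matrix (Fin 2) (Fin 2) ℝ) (hS : ∀ ν l, (S ν l).IsSymm)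
    (hne : ∀ ν, ∃ y : ℝ, 0 < y ∧ (∑ l, (y ^ (δs ν l)) • S ν l).det ≠ 0)
    (R : ℝ) (x : ℕ → Fin 20 → ℝ) (hx : ∀ ν, StrictMono (x ν)) (hxpos : ∀ ν k, 0 < x ν k)
    (hxR : ∀ ν k, x ν k ≤ R * x ν 0) (hroot : ∀ ν k, (∑ l, (x ν k ^ (δs ν l)) • S ν l).det = 0) : False :=
  no_boundedRatio_twenties_twoWeylPairs_of_nondeg δ0 h50 h41
    (fun W hWs hWne => doublyConfluentDet_ne_zero_of_polar_ne_zero_wallC3 δ0 h50 h41 hrel hgen W hWs hWne)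
    δs hδ S hS hne R x hx hxpos hxR hroot

end Summit.ValiantsHypothesis.ValiantsHypothesis.Theorems.LacunarySymmetroidMatrixDescartes.WallBubbling
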